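import Summits.BirchSwinnertonDyer.BirchSwinnertonDyer.Theorems.ManinLocalTwoThreeDyadicUntwistTransport
import Summits.BirchSwinnertonDyer.BirchSwinnertonDyer.Theorems.ManinLocalTwoThreeNegOneTwistIstarThreeIIstar
import Summits.BirchSwinnertonDyer.BirchSwinnertonDyer.Theorems.ManinLocalTwoThreeNegOneTwistIstarDeep
import Summits.BirchSwinnertonDyer.BirchSwinnertonDyer.Theorems.ManinLocalTwoThreeConductorExponentFourAtTwo
import Literature.NumberTheory.EllipticCurves.IsogenyConductorModularityProofs
import Literature.NumberTheory.EllipticCurves.ManinConstantSemistablePrimewise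
import Literature.NumberTheory.DiophantineGeometry.ConductorFactorizationProofs
import HarnessLib

/-!
# C2 `ManinOddAtFour` HOLDS whenever some dyadic twist `W ⊗ ℚ(√d)`, `d ∈ {−1, 2, −2}`, is SEMISTABLE at `2` — in particular on the
# `f₂ = 4` strata `(4, 0) ∪ (4, 1)` of S-an-63 (Kodaira rows `I₄*/12`, `II*/12`, `Iₙ≥5*/(n+8)`), GIVEN the crux's four printed-fact binders
# (route `ManinLocalTwoThree`, crux C2 stmt-BirchSwinnertonDyer-22967; cell bsd-f2-manin, p2 gen 14)

The packaging, by name, of this seat's dyadic untwist transport `maninLocalTwoThree_not_dvd_maninConstant_of_dyadicUntwist_semistable` (g10; Stevens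
1989 (5.2)/(5.4), `η = 1` AND `η = 2`) with the printed semistable-prime theorem (`cesnavicius2018_not_dvd_maninConstant_of_not_sq_dvd_level`:
Mazur 1978 / Abbes–Ullmo 1996 / Česnavičius 2018, with Carayol `N = N(W)` and isogeny invariance of `N` from modularity):
* §1 `not_two_dvd_maninConstant_of_conductorExponent_quadraticTwist_le_one`: `4 ∣ N`, `f₂(W ⊗ d) ≤ 1` for some `d ∈ {−1, 2, −2}` ⟹ every
  lattice-optimal `X₀(N)`-datum of the globally minimal `W` has odd Manin constant (`W ∼ W′ ⊗ ℚ(√d)` with `W′` a globally minimal model of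
  `W ⊗ d`, `4 ∤ N(W′)`);
* §2 the `f₂ = 4` strata whose `χ₋₄`-twist is semistable, by the Kodaira rows of S-an-63 landed by p3 g12 (`…NegOneTwistIstarDeep`: `I₄*/12 ↦ f = 0`,
  `Iₙ≥5*/(n+8) ↦ f = 1`; `…NegOneTwistIstarThreeIIstar`: `II*/12 ↦ f = 0`): `2 ∤ c` on `I₄*/12`, `II*/12`, `Iₙ≥5*/(n+8)`;
* §3 `not_two_dvd_maninConstant_of_conductorExponent_eq_four_of_not_wildRow`: at `16 ∥ N` the open content of C2 is the four rows `II/4`, `I₀*/8`,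
  `I₂*/10`, `I₃*/11` (the strata `(4, 2) ∪ (4, 3)`, whose twists are again additive), by p3's type list `kodairaSymbolAt_of_conductorExponent_eq_four_two`.
HONEST FRAMING: by-name partial discharges of the crux on explicit E-blind strata, modulo exactly the crux's printed-fact binders; assembled from
print (Stevens, Pal, Česnavičius), printed nowhere as such.  Nothing about BSD is proved; Manin's conjecture at `2` stays OPEN on the remaining
strata; C2 OPEN. [cite: Stevens1989, Lemmas (5.2), (5.4) pp. 96–97] [cite: Cesnavicius2018, Thm. 1.2] [cite: Mazur1978, Cor. 4.1]
[cite: AbbesUllmo1996, Thm. A] [cite: BarriosEtAl2025, Thm. 5.1 (arXiv:2501.03209 pp. 15–16), rows I₄*, II*, Iₙ≥5*]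
-/

set_option autoImplicit false
-- lint-debt: the directory name repeats the summit name (sibling precedent `ManinLocalTwoThreeDyadicUntwistTransport.lean`)
set_option linter.dupNamespace false

noncomputable section

open scoped Classical
open WeierstrassCurve IsDedekindDomain IsDedekindDomain.HeightOneSpectrum Rat.HeightOneSpectrum
  Literature.NumberTheory.DiophantineGeometry Literature.NumberTheory.EllipticCurves
  Literature.NumberTheory.EllipticCurves.ModularForms

namespace Summit.BirchSwinnertonDyer.BirchSwinnertonDyer.Theorems.ManinLocalTwoThree

/-! ## §1 A semistable dyadic twist forces `2 ∤ c` -/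

/-- **If `W ⊗ ℚ(√d)` is semistable at `2` for some `d ∈ {−1, 2, −2}`, then `2 ∤ c` for every lattice-optimal `X₀(N)`-datum of the globally
minimal `W` with `4 ∣ N`**, granted the four printed facts (Mazur, Abbes–Ullmo, Česnavičius, modularity): `W ∼ W′ ⊗ ℚ(√d)` for a globally
minimal model `W′` of `W ⊗ d` (`(W ⊗ d) ⊗ d = W ⊗ d² ≅ W`), `4 ∤ N(W′)` (`f₂(W′) = f₂(W ⊗ d) ≤ 1`), `2 ∤ c` on the class of `W′`
(`cesnavicius2018_not_dvd_maninConstant_of_not_sq_dvd_level`, Carayol, isogeny invariance of `N`), and the dyadic untwist transport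
`maninLocalTwoThree_not_dvd_maninConstant_of_dyadicUntwist_semistable` (Stevens `η = 1`, `2`).
[cite: Stevens1989, Lemmas (5.2), (5.4)] [cite: Cesnavicius2018, Thm. 1.2] [cite: SilvermanAEC2009, X.5 Cor. 5.4] -/
theorem not_two_dvd_maninConstant_of_conductorExponent_quadraticTwist_le_one
    (hM : mazur_not_dvd_maninConstant_of_odd) (hAU : abbesUllmo_not_dvd_maninConstant_of_not_dvd_level)
    (hC2 : cesnavicius_not_two_dvd_maninConstant_of_two_dvd_level) (hnf : exists_isNewformOf)
    {W : WeierstrassCurve ℚ} [W.IsElliptic] [W.IsGloballyMinimal] {N : ℕ} [NeZero N] (D : ModularParametrizationData W N)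
    (hopt : ∀ z ∈ D.L.lattice, ∃ w ∈ periodLattice D.f, z = D.c * w) (h4 : 2 ^ 2 ∣ N)
    {d : ℤ} (hd : d = -1 ∨ d = 2 ∨ d = -2)
    (hf : (haveI := W.isElliptic_quadraticTwist (show ((d : ℤ) : ℚ) ≠ 0 by exact_mod_cast (show d ≠ 0 by omega));
      (W.quadraticTwist (d : ℚ)).conductorExponent ((primesEquiv (R := ℤ)).symm ⟨2, Nat.prime_two⟩)) ≤ 1) :
    ¬ (2 : ℤ) ∣ D.maninConstant := by
  haveI : Fact (Nat.Prime 2) := ⟨Nat.prime_two⟩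
  have hd0 : ((d : ℤ) : ℚ) ≠ 0 := by exact_mod_cast (show d ≠ 0 by omega)
  haveI := W.isElliptic_quadraticTwist hd0
  have hmod : nonempty_modularParametrizationData := maninLocalTwoThree_nonempty_modularParametrizationData_of_exists_isNewformOf hnf
  set v : HeightOneSpectrum ℤ := (primesEquiv (R := ℤ)).symm ⟨2, Nat.prime_two⟩ with hvdef
  have hv : natGenerator v = 2 := congrArg Subtype.val ((primesEquiv (R := ℤ)).apply_symm_apply ⟨2, Nat.prime_two⟩)
  have hfac : ∀ (V : WeierstrassCurve ℚ) [V.IsElliptic], (V.conductorNorm ℤ).factorization 2 = V.conductorExponent v := by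
    intro V _; rw [← hv]; exact V.factorization_conductorNorm_holds v
  -- a globally minimal model `W'` of `W ⊗ d`, semistable at `2`
  obtain ⟨C₁, hC₁⟩ := hasGlobalMinimalModel_rat_holds (W.quadraticTwist (d : ℚ))
  haveI := hC₁
  set W' : WeierstrassCurve ℚ := C₁ • W.quadraticTwist (d : ℚ) with hW'
  have hf' : W'.conductorExponent v ≤ 1 := by rw [hW', conductorExponent_smul']; exact hf
  have h4N' : ¬ 2 ^ 2 ∣ W'.conductorNorm ℤ := fun h ↦ by
    have := (Nat.prime_two.pow_dvd_iff_le_factorization (W'.conductorNorm_pos_holds).ne').mp h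
    rw [hfac W'] at this
    omega
  -- `W ∼ W' ⊗ d`: `W' ⊗ d ≅ (W ⊗ d) ⊗ d = W ⊗ d² ≅ W`
  haveI := W'.isElliptic_quadraticTwist hd0
  obtain ⟨C₂, hC₂⟩ := W.exists_variableChange_quadraticTwist_mul_sq 1 (d : ℚ) hd0
  obtain ⟨C₃, hC₃⟩ := W.exists_variableChange_quadraticTwist_one
  have hWW' : W'.quadraticTwist (d : ℚ) = ((⟨C₁.u, (d : ℚ) * C₁.r, 0, 0⟩ : VariableChange ℚ) * C₂ * C₃) • W := by
    rw [mul_smul, mul_smul, hC₃, hC₂, hW', WeierstrassCurve.quadraticTwist_smul, WeierstrassCurve.quadraticTwist_quadraticTwist]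
    congr 2
    ring
  have htw : IsIsogenous W (W'.quadraticTwist (d : ℚ)) := by rw [hWW']; exact isIsogenous_smul W _
  -- `2 ∤ c` on the class of `W'` (printed, `4 ∤ N`)
  have hp : ∀ (W₁ : WeierstrassCurve ℚ) [W₁.IsElliptic] [W₁.IsGloballyMinimal] {N₁ : ℕ} [NeZero N₁]
      (D₁ : ModularParametrizationData W₁ N₁), IsIsogenous W' W₁ →
      (∀ z ∈ D₁.L.lattice, ∃ w ∈ periodLattice D₁.f, z = D₁.c * w) → ¬ (2 : ℤ) ∣ D₁.maninConstant := by
    intro W₁ _ _ N₁ _ D₁ hiso hopt₁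
    have hN₁ : N₁ = W₁.conductorNorm ℤ := IsNewformOf.level_eq_conductorNorm_of_exists_isNewformOf hnf D₁.isNewformOf
    have hNN : W'.conductorNorm ℤ = W₁.conductorNorm ℤ := conductorNorm_eq_of_isIsogenous_of_modularity_of_isGloballyMinimal hmod hiso
    have h4N₁ : ¬ 2 ^ 2 ∣ N₁ := by rw [hN₁, ← hNN]; exact h4N'
    exact_mod_cast cesnavicius2018_not_dvd_maninConstant_of_not_sq_dvd_level hM hAU hC2 W₁ D₁ hopt₁ Nat.prime_two h4N₁
  exact maninLocalTwoThree_not_dvd_maninConstant_of_dyadicUntwist_semistable hnf D hopt h4 hd htw h4N' hp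

/-! ## §2 The `f₂ = 4` strata whose `χ₋₄`-twist is semistable: rows `I₄*/12`, `II*/12`, `Iₙ≥5*/(n+8)` -/

/-- **C2 on the rows `I₄*/12`, `II*/12`, `Iₙ≥5*/(n+8)`** (the strata `(f₂, f₂(⊗χ₋₄)) = (4, 0), (4, 1)` of Barrios et al.'s Table; the twists of the
curves good resp. multiplicative at `2` by `χ₋₄`): every lattice-optimal `X₀(N)`-datum of a globally minimal `W` of one of these types at `2`, `4 ∣ N`,
has ODD Manin constant, granted the four printed facts.  By §1 with `d = −1` and the rows of p3 g12
(`conductorExponent_quadraticTwist_negOne_of_IstarFour_twelve` `= 0`, `…_of_IIstar_twelve` `= 0`, `…_of_Istar_of_five_le` `= 1`).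
[cite: BarriosEtAl2025, Thm. 5.1, Table localdata-dodd, rows I₄*, II*, I*_{n≥5} (arXiv:2501.03209 p. 16)] [cite: Stevens1989, Lemma (5.2)]
[cite: Cesnavicius2018, Thm. 1.2] -/
theorem not_two_dvd_maninConstant_of_semistableTwistRow
    (hM : mazur_not_dvd_maninConstant_of_odd) (hAU : abbesUllmo_not_dvd_maninConstant_of_not_dvd_level)
    (hC2 : cesnavicius_not_two_dvd_maninConstant_of_two_dvd_level) (hnf : exists_isNewformOf)
    {W : WeierstrassCurve ℚ} [W.IsElliptic] [W.IsGloballyMinimal] {N : ℕ} [NeZero N] (D : ModularParametrizationData W N)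
    (hopt : ∀ z ∈ D.L.lattice, ∃ w ∈ periodLattice D.f, z = D.c * w) (h4 : 2 ^ 2 ∣ N)
    (hK : (W.kodairaSymbolAt ((primesEquiv (R := ℤ)).symm ⟨2, Nat.prime_two⟩) = .Istar 4 ∧
        W.ordMinimalDiscriminant ((primesEquiv (R := ℤ)).symm ⟨2, Nat.prime_two⟩) = 12) ∨
      (W.kodairaSymbolAt ((primesEquiv (R := ℤ)).symm ⟨2, Nat.prime_two⟩) = .IIstar ∧
        W.ordMinimalDiscriminant ((primesEquiv (R := ℤ)).symm ⟨2, Nat.prime_two⟩) = 12) ∨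
      (∃ n : ℕ, W.kodairaSymbolAt ((primesEquiv (R := ℤ)).symm ⟨2, Nat.prime_two⟩) = .Istar (n + 5) ∧
        W.ordMinimalDiscriminant ((primesEquiv (R := ℤ)).symm ⟨2, Nat.prime_two⟩) = n + 13)) :
    ¬ (2 : ℤ) ∣ D.maninConstant := by
  refine not_two_dvd_maninConstant_of_conductorExponent_quadraticTwist_le_one hM hAU hC2 hnf D hopt h4 (Or.inl rfl) ?_
  rcases hK with ⟨hT, hord⟩ | ⟨hT, hord⟩ | ⟨n, hT, hord⟩
  · exact (conductorExponent_quadraticTwist_negOne_of_IstarFour_twelve W hT hord).le.trans zero_le_one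
  · exact (conductorExponent_quadraticTwist_negOne_of_IIstar_twelve W hT hord).le.trans zero_le_one
  · exact (conductorExponent_quadraticTwist_negOne_of_Istar_of_five_le W (n := n + 5) (by omega) hT hord).le

/-! ## §3 At `16 ∥ N` the open content of C2 is the four wild rows `II/4`, `I₀*/8`, `I₂*/10`, `I₃*/11` -/

/-- **C2 at `16 ∥ N`, off the rows `II`, `I₀*`, `I₂*`, `I₃*`**: for a globally minimal `W` with `f₂(W) = 4` whose Kodaira type at `2` is none of
`II`, `I₀*`, `I₂*`, `I₃*`, every lattice-optimal `X₀(N)`-datum with `4 ∣ N` has odd Manin constant (granted the four printed facts): by p3's type list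
`kodairaSymbolAt_of_conductorExponent_eq_four_two` the remaining rows are `I₄*/12`, `II*/12`, `Iₙ≥5*/(n+8)` (§2).  So on `16 ∥ N` C2 is OPEN exactly on
the strata `(4, 2) ∪ (4, 3)` (rows `II/4`, `I₀*/8`, `I₂*/10`, `I₃*/11`, whose `χ₋₄`-twists are again additive, `f₂ ∈ {2, 3}`).
[cite: BarriosEtAl2025, Thm. 5.1, Table localdata-dodd (arXiv:2501.03209 pp. 15–16)] [cite: Stevens1989, Lemma (5.2)] [cite: Cesnavicius2018, Thm. 1.2] -/
theorem not_two_dvd_maninConstant_of_conductorExponent_eq_four_of_not_wildRow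
    (hM : mazur_not_dvd_maninConstant_of_odd) (hAU : abbesUllmo_not_dvd_maninConstant_of_not_dvd_level)
    (hC2 : cesnavicius_not_two_dvd_maninConstant_of_two_dvd_level) (hnf : exists_isNewformOf)
    {W : WeierstrassCurve ℚ} [W.IsElliptic] [W.IsGloballyMinimal] {N : ℕ} [NeZero N] (D : ModularParametrizationData W N)
    (hopt : ∀ z ∈ D.L.lattice, ∃ w ∈ periodLattice D.f, z = D.c * w) (h4 : 2 ^ 2 ∣ N)
    (hf : W.conductorExponent ((primesEquiv (R := ℤ)).symm ⟨2, Nat.prime_two⟩) = 4)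
    (hII : W.kodairaSymbolAt ((primesEquiv (R := ℤ)).symm ⟨2, Nat.prime_two⟩) ≠ .II)
    (hI0 : W.kodairaSymbolAt ((primesEquiv (R := ℤ)).symm ⟨2, Nat.prime_two⟩) ≠ .Istar 0)
    (hI2 : W.kodairaSymbolAt ((primesEquiv (R := ℤ)).symm ⟨2, Nat.prime_two⟩) ≠ .Istar 2)
    (hI3 : W.kodairaSymbolAt ((primesEquiv (R := ℤ)).symm ⟨2, Nat.prime_two⟩) ≠ .Istar 3) :
    ¬ (2 : ℤ) ∣ D.maninConstant := by
  set v : HeightOneSpectrum ℤ := (primesEquiv (R := ℤ)).symm ⟨2, Nat.prime_two⟩ with hvdef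
  have hv : natGenerator v = 2 := congrArg Subtype.val ((primesEquiv (R := ℤ)).apply_symm_apply ⟨2, Nat.prime_two⟩)
  refine not_two_dvd_maninConstant_of_semistableTwistRow hM hAU hC2 hnf D hopt h4 ?_
  rcases kodairaSymbolAt_of_conductorExponent_eq_four_two W v hv hf with
    ⟨h, -⟩ | ⟨h, -⟩ | ⟨h, -⟩ | ⟨h, -⟩ | ⟨h, h'⟩ | ⟨h, h'⟩ | ⟨n, h, h'⟩
  · exact absurd h hII
  · exact absurd h hI0
  · exact absurd h hI2
  · exact absurd h hI3
  · exact Or.inl ⟨h, h'⟩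
  · exact Or.inr (Or.inl ⟨h, h'⟩)
  · exact Or.inr (Or.inr ⟨n, h, h'⟩)

end Summit.BirchSwinnertonDyer.BirchSwinnertonDyer.Theorems.ManinLocalTwoThree

end
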